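import Summits.RiemannHypothesis.RiemannHypothesis.Theorems.SoloInformedGroundStateDefect

/-!
# Ground-state endgame, VI b: bounds on the reflection defect and the `Ω`-form of the criterion

Solo programme `solo-RiemannHypothesis-informed`, session 4 (companion of
`SoloInformedGroundStateDefect`).  Notation as there: `Z_T = Z_T^{on} + Z_T^{off}` (zeros on / off
the critical line up to height `T`), `D_T` the reflection defect.

* `defectSum_le_four_mul_offline`: `D_T(g) ≤ 4 Z_T^{off}(g)` (from `|x − y|² ≤ 2|x|² + 2|y|²` and the
  reflection symmetry `ρ ↦ 1 − ρ̄` of the off-line multiset).  The constant `4` is the right one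
  (`x_ρ = −x_{ρ*}` gives equality termwise); this corrects the informal remark "`D ≤ 2 Z^{off}`" in the
  first version of the module docstring of part VI.
* `re_weilZeroSidePartial_weilQuadratic_ge_on_sub_off`: hence `Re Q_T(g) ≥ Z_T^{on}(g) − Z_T^{off}(g)`,
  sharpening `re_weilZeroSidePartial_weilQuadratic_ge` (`≥ −Z_T^{off}`) by the on-line energy.
* `near_minimisers_zeroSum_large_of_not_riemannHypothesis` and `near_minimisers_zeroSum_dichotomy`:
  the failure branch made quantitative with the thermometer — if RH fails there is `κ > 0` such that
  for every `C`, on arbitrarily large windows `a`, EVERY near-minimiser `g` with slack `s` has a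
  truncated zero-sampling energy `Z_T(g) > C e^{κ a} − s`.
-/

noncomputable section

open Complex Filter Set Topology Metric MeasureTheory
open Literature.NumberTheory.LFunctions Literature.NumberTheory.LFunctions.WeilContinuous
open scoped ComplexConjugate

namespace Summit.RiemannHypothesis.RiemannHypothesis.Theorems

section DefectBounds

variable {g : ℝ → ℂ}

/-- The off-line index is stable under `ρ ↦ 1 − ρ̄`. -/
theorem one_sub_conj_mem_weilZeroIndex_offline {T : ℝ} {ρ : ℂ}
    (hρ : ρ ∈ weilZeroIndex T ∩ {ρ | ρ.re ≠ 1 / 2}) :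
    1 - conj ρ ∈ weilZeroIndex T ∩ {ρ | ρ.re ≠ 1 / 2} := by
  refine ⟨one_sub_conj_mem_weilZeroIndex hρ.1, ?_⟩
  have h := hρ.2
  simp only [mem_setOf_eq, sub_re, one_re, conj_re] at h ⊢
  intro h'
  apply h
  linarith

/-- **`D_T ≤ 4 Z_T^{off}`.** -/
theorem defectSum_le_four_mul_offline (g : ℝ → ℂ) (T : ℝ) :
    (∑ᶠ ρ ∈ weilZeroIndex T,
        (riemannZetaZeroOrder ρ : ℝ) * ‖weilMellin g ρ - weilMellin g (1 - conj ρ)‖ ^ 2) ≤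
      4 * ∑ᶠ ρ ∈ weilZeroIndex T ∩ {ρ | ρ.re ≠ 1 / 2},
        (riemannZetaZeroOrder ρ : ℝ) * ‖weilMellin g ρ‖ ^ 2 := by
  rw [defectSum_eq_offline g T]
  have hfin' : (weilZeroIndex T ∩ {ρ | ρ.re ≠ 1 / 2}).Finite :=
    (weilZeroIndex_finite T).subset inter_subset_left
  have hmem : ∀ ρ, ρ ∈ hfin'.toFinset ↔ ρ ∈ weilZeroIndex T ∩ {ρ | ρ.re ≠ 1 / 2} :=
    fun ρ ↦ hfin'.mem_toFinset
  rw [finsum_mem_eq_finite_toFinset_sum _ hfin', finsum_mem_eq_finite_toFinset_sum _ hfin']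
  set F := hfin'.toFinset with hF
  have hreindex : ∑ ρ ∈ F, (riemannZetaZeroOrder ρ : ℝ) * ‖weilMellin g (1 - conj ρ)‖ ^ 2 =
      ∑ ρ ∈ F, (riemannZetaZeroOrder ρ : ℝ) * ‖weilMellin g ρ‖ ^ 2 := by
    refine Finset.sum_nbij' (fun ρ ↦ 1 - conj ρ) (fun ρ ↦ 1 - conj ρ) ?_ ?_ ?_ ?_ ?_
    · intro ρ hρ
      exact (hmem _).2 (one_sub_conj_mem_weilZeroIndex_offline ((hmem ρ).1 hρ))
    · intro ρ hρ
      exact (hmem _).2 (one_sub_conj_mem_weilZeroIndex_offline ((hmem ρ).1 hρ))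
    · intro ρ _
      simp
    · intro ρ _
      simp
    · intro ρ hρ
      obtain ⟨h0, h1⟩ := re_pos_and_lt_one_of_mem_weilZeroIndex ((hmem ρ).1 hρ).1
      simp only [riemannZetaZeroOrder_one_sub_conj h0 h1]
  have hterm : ∀ ρ ∈ F,
      (riemannZetaZeroOrder ρ : ℝ) * ‖weilMellin g ρ - weilMellin g (1 - conj ρ)‖ ^ 2 ≤
        2 * ((riemannZetaZeroOrder ρ : ℝ) * ‖weilMellin g ρ‖ ^ 2) +
          2 * ((riemannZetaZeroOrder ρ : ℝ) * ‖weilMellin g (1 - conj ρ)‖ ^ 2) := by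
    intro ρ hρ
    have hm := riemannZetaZeroOrder_nonneg_of_mem_weilZeroIndex ((hmem ρ).1 hρ).1
    have h2 : ‖weilMellin g ρ - weilMellin g (1 - conj ρ)‖ ^ 2 ≤
        2 * ‖weilMellin g ρ‖ ^ 2 + 2 * ‖weilMellin g (1 - conj ρ)‖ ^ 2 := by
      have h := norm_sub_le (weilMellin g ρ) (weilMellin g (1 - conj ρ))
      have hx := norm_nonneg (weilMellin g ρ)
      have hy := norm_nonneg (weilMellin g (1 - conj ρ))
      have hxy := norm_nonneg (weilMellin g ρ - weilMellin g (1 - conj ρ))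
      nlinarith [sq_nonneg (‖weilMellin g ρ‖ - ‖weilMellin g (1 - conj ρ)‖)]
    nlinarith
  calc ∑ ρ ∈ F, (riemannZetaZeroOrder ρ : ℝ) * ‖weilMellin g ρ - weilMellin g (1 - conj ρ)‖ ^ 2
      ≤ ∑ ρ ∈ F, (2 * ((riemannZetaZeroOrder ρ : ℝ) * ‖weilMellin g ρ‖ ^ 2) +
          2 * ((riemannZetaZeroOrder ρ : ℝ) * ‖weilMellin g (1 - conj ρ)‖ ^ 2)) :=
        Finset.sum_le_sum hterm
    _ = 4 * ∑ ρ ∈ F, (riemannZetaZeroOrder ρ : ℝ) * ‖weilMellin g ρ‖ ^ 2 := by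
        rw [Finset.sum_add_distrib, ← Finset.mul_sum, ← Finset.mul_sum, hreindex]
        ring

/-- `Z_T = Z_T^{on} + Z_T^{off}`. -/
theorem zeroSum_eq_online_add_offline (g : ℝ → ℂ) (T : ℝ) :
    (∑ᶠ ρ ∈ weilZeroIndex T, (riemannZetaZeroOrder ρ : ℝ) * ‖weilMellin g ρ‖ ^ 2) =
      (∑ᶠ ρ ∈ weilZeroIndex T ∩ {ρ | ρ.re = 1 / 2}, (riemannZetaZeroOrder ρ : ℝ) * ‖weilMellin g ρ‖ ^ 2) +
        ∑ᶠ ρ ∈ weilZeroIndex T ∩ {ρ | ρ.re ≠ 1 / 2}, (riemannZetaZeroOrder ρ : ℝ) * ‖weilMellin g ρ‖ ^ 2 := by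
  have hfin := weilZeroIndex_finite T
  have hfin₁ : (weilZeroIndex T ∩ {ρ | ρ.re = 1 / 2}).Finite := hfin.subset inter_subset_left
  have hfin₂ : (weilZeroIndex T ∩ {ρ | ρ.re ≠ 1 / 2}).Finite := hfin.subset inter_subset_left
  have h₁ : hfin₁.toFinset = hfin.toFinset.filter (fun ρ ↦ ρ.re = 1 / 2) := by
    ext ρ
    simp [Set.Finite.mem_toFinset, Finset.mem_filter]
  have h₂ : hfin₂.toFinset = hfin.toFinset.filter (fun ρ ↦ ¬ ρ.re = 1 / 2) := by
    ext ρ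
    simp [Set.Finite.mem_toFinset, Finset.mem_filter]
  rw [finsum_mem_eq_finite_toFinset_sum _ hfin, finsum_mem_eq_finite_toFinset_sum _ hfin₁,
    finsum_mem_eq_finite_toFinset_sum _ hfin₂, h₁, h₂, Finset.sum_filter_add_sum_filter_not]

/-- **`Re Q_T ≥ Z_T^{on} − Z_T^{off}`** (the on-line energy enters with the good sign). -/
theorem re_weilZeroSidePartial_weilQuadratic_ge_on_sub_off (hg : IsWeilTest g) (T : ℝ) :
    (∑ᶠ ρ ∈ weilZeroIndex T ∩ {ρ | ρ.re = 1 / 2}, (riemannZetaZeroOrder ρ : ℝ) * ‖weilMellin g ρ‖ ^ 2) -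
        (∑ᶠ ρ ∈ weilZeroIndex T ∩ {ρ | ρ.re ≠ 1 / 2}, (riemannZetaZeroOrder ρ : ℝ) * ‖weilMellin g ρ‖ ^ 2) ≤
      (weilZeroSidePartial (weilConv g (weilReflect g)) T).re := by
  rw [re_weilZeroSidePartial_weilQuadratic_eq hg T, zeroSum_eq_online_add_offline g T]
  linarith [defectSum_le_four_mul_offline g T]

end DefectBounds

/-! ## The failure branch, quantitatively -/

section Omega

/-- **If RH fails, near-minimisers carry exponentially large zero-sampling energy.**  There is
`κ > 0` such that for every `C`, on arbitrarily large windows `a`, every test `g` with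
`Re Q(g) ≤ ε(a) + s` has `Z_T(g) > C e^{κ a} − s` for some `T`. -/
theorem near_minimisers_zeroSum_large_of_not_riemannHypothesis (h : ¬ RiemannHypothesis) :
    ∃ κ : ℝ, 0 < κ ∧ ∀ C : ℝ, ∃ᶠ a in atTop, ∀ (g : ℝ → ℂ) (s : ℝ), IsWeilTest g →
      (weilQuadratic g).re ≤ weilGroundEnergy a + s →
        ∃ T : ℝ, C * Real.exp (κ * a) - s <
          ∑ᶠ ρ ∈ weilZeroIndex T, (riemannZetaZeroOrder ρ : ℝ) * ‖weilMellin g ρ‖ ^ 2 := by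
  obtain ⟨κ, hκ, hfreq⟩ := exists_frequently_weilGroundEnergy_lt_of_not_riemannHypothesis h
  refine ⟨κ, hκ, fun C ↦ (hfreq C).mono fun a ha g s hg hmin ↦ ?_⟩
  exact exists_zeroSum_gt_of_weilGroundEnergy_lt hg hmin (by linarith)

/-- **Dichotomy for near-minimisers.**  Either (RH) bounded-slack near-minimisers of bounded
zero-sampling energy exist on all large windows, or (`¬`RH) on arbitrarily large windows every
near-minimiser with slack `s` has zero-sampling energy exceeding `C e^{κ a} − s`, for some fixed
`κ > 0` and every `C`. -/
theorem near_minimisers_zeroSum_dichotomy :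
    (∃ B a₀ : ℝ, ∀ a : ℝ, a₀ ≤ a → ∃ (g : ℝ → ℂ) (s : ℝ), IsWeilTest g ∧
      (weilQuadratic g).re ≤ weilGroundEnergy a + s ∧ s ≤ B ∧
      ∀ T : ℝ, ∑ᶠ ρ ∈ weilZeroIndex T, (riemannZetaZeroOrder ρ : ℝ) * ‖weilMellin g ρ‖ ^ 2 ≤ B) ∨
    ∃ κ : ℝ, 0 < κ ∧ ∀ C : ℝ, ∃ᶠ a in atTop, ∀ (g : ℝ → ℂ) (s : ℝ), IsWeilTest g →
      (weilQuadratic g).re ≤ weilGroundEnergy a + s →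
        ∃ T : ℝ, C * Real.exp (κ * a) - s <
          ∑ᶠ ρ ∈ weilZeroIndex T, (riemannZetaZeroOrder ρ : ℝ) * ‖weilMellin g ρ‖ ^ 2 := by
  by_cases h : RiemannHypothesis
  · exact Or.inl (riemannHypothesis_iff_near_minimisers_zeroSum_bounded.1 h)
  · exact Or.inr (near_minimisers_zeroSum_large_of_not_riemannHypothesis h)

end Omega

end Summit.RiemannHypothesis.RiemannHypothesis.Theorems
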